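import Literature.AnabelianGeometry.SemiGraphs.CoveringRestrictComparisonProofs2
import Literature.AnabelianGeometry.SemiGraphs.MatchedStabilizersOfRestrictGlobal
import Literature.AnabelianGeometry.SemiGraphs.CoveringOfObjectVertexAligned
import Literature.AnabelianGeometry.SemiGraphs.FiniteEtaleCoveringConnectedProofs
import HarnessLib

/-!
# (D3) «components of `φ⁻¹(ℍ)` ↔ `Π_ℍ \ Π_𝒢 / Π′`» at the covering of record `𝒢_A → 𝒢`, for EVERY object `A`
([SemiAnbd] Cor. 2.7 (i) p. 30, Rem. 2.2.1 p. 24)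

Mochizuki, *Semi-graphs of anabelioids*, Publ. RIMS **42** (2006) 221–322, §2: proof of Corollary 2.7 (i),
author's manuscript p. 30 ("whose restriction to `ℍ` … we denote by `ℋ′ → ℍ`", "a connected component `ℋ″`
of `ℋ′`", "`ℋ′` injects into `𝒢′` as a subgraph") and Remark 2.2.1 p. 24 (images of fundamental groups
along a finite étale covering are decomposition groups = stabilizers)
[cite: MochizukiSemiAnbd2006, Cor. 2.7(i) p.30] [cite: MochizukiSemiAnbd2006, Rem. 2.2.1 p.24].

abc-iut cell, block C / F wave, FACT-LIST row F-1487 (`covering_subgraphComponents_doubleCosets`,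
`FiniteEtaleCoveringDictionary.lean`, abc-iut-L3-d3): the INSTANCE FORM of the dictionary item (D3) at the
covering of record `φ := A.coveringHomCan : 𝒢_A → 𝒢` (abc-iut-L3-t5) for EVERY object `A ∈ B(𝒢)` with
`𝒢_A` connected — not only for Galois `A`.  PROOF-ONLY file (no `def`, no new named fact); seat
abc-iut-w6-d036.  Assembly of kernel theorems already in the tree, consumed BY NAME:

* (RS-cov) abc-iut-L3-d3's `BObj.restrict_isGlobalCoveringOf` (`CoveringRestrictComparisonProofs2.lean`):
  the restriction `𝒢_A|_K → 𝒢|_ℍ` to a preimage component `K` is GLOBALLY the covering attached to the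
  sub-object `Z_K ↪ A|_ℍ` cut out by `K` — a Galois-free theorem; here re-indexed into the binder shape of
  abc-iut-w5-d041's reduction (`restrictGlobal_coveringHomCan_all`; the tree's `restrictGlobal_coveringHomCan`,
  `Corollary27iHolds.lean`, carries an `IsGalois A` binder which its proof never uses);
* (ST ⇐ RS) abc-iut-w5-d041's `matchedStabilizers_coveringHomCan_of_restrictGlobal`
  (`MatchedStabilizersOfRestrictGlobal.lean`): matched stabilizers from (RS), for every `A`;
* (D3 ⇐ ST) abc-iut-w5-d041's `subgraphComponents_doubleCosets_coveringHomCan_of_stabilizers`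
  (`SubgraphComponentsDoubleCosetsOfStabilizers.lean`, with abc-iut-L6-t17's bridge/transport and
  abc-iut-w4-d071's closer shape);
* the dischargers of the standing clauses of `𝒢_A → 𝒢`: abc-iut-L3-t5's
  `coveringHomCan_isFiniteEtaleCoveringOf`, `coveringHomCan_isGlobalCoveringOf`, abc-iut-w4-d071's
  `coveringHomCan_isVertexAligned`, and (D8) `covering_isConnected_holds` (abc-iut-L6-t17 lineage).

Results:

* `restrictGlobal_coveringHomCan_all` — (RS) for every `A` (binder shape of the (ST) reduction);
* `matchedStabilizers_coveringHomCan` — (ST) «matched stabilizers at the SAME fibre point» for every `A`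
  with `𝒢`, `𝒢_A` connected (the tree had it for Galois `A`: `matchedStabilizers_coveringHomCan_galois`);
* `subgraphComponents_doubleCosets_coveringHomCan` — (D3), all four clauses (P1)–(P4), in the VERBATIM
  binder shape of the dictionary item with `𝒢′ := A.coveringGraph`, `φ := A.coveringHomCan`, for every
  such `A` (the tree had it for Galois `A`: `subgraphComponents_doubleCosets_coveringHomCan_galois`);
* `subgraphComponents_doubleCosets_coveringHomCan_of_isConnected` — the CLEAN form: `𝒢` connected and
  `A` connected ⇒ (D3) at `𝒢_A → 𝒢`, with the local / global / vertex-alignment / connectedness clauses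
  of the covering of record DISCHARGED by the theorems above (no hypothesis beyond the two
  connectedness assumptions and the base-point data).

Honest framing: this is the INSTANCE form of F-1487 at print's constructed covering (p. 23 / p. 30); the
ABSTRACT form (every `φ` which is «local ∧ global ∧ vertex-aligned») is NOT proved here and stays open as
typed (it needs a uniqueness/rigidity theorem for attached coverings).  [SemiAnbd] is a published,
refereed prerequisite; nothing here bears on [IUTchIII] Cor. 3.12; typed ≠ proved for the abstract form.
-/

namespace Literature.AnabelianGeometry.SemiGraphs

namespace SemiGraphOfAnabelioids

open CategoryTheory CategoryTheory.Limits CategoryTheory.Functor CategoryTheory.PreGaloisCategory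
open Literature.AnabelianGeometry.Anabelioids
open scoped Pointwise

universe v₁ u₁ u

/-! ### A. (RS) for the covering of record, every object `A` -/

/-- **(RS) — the global clause of the restricted coverings `𝒢_A|_K → 𝒢|_ℍ`, for EVERY object `A`**
(abc-iut-L3-d3's `BObj.restrict_isGlobalCoveringOf`, re-indexed into the binder shape of
`matchedStabilizers_coveringHomCan_of_restrictGlobal`): for `𝒢` connected, `𝒢_A` connected, a connected
sub-graph `ℍ`, a preimage component `K` and ANY sub-object `m : Z ↪ A|_ℍ` of `B(𝒢_ℍ)` whose fibre images
are the ones cut out by `K`, the restricted morphism `𝒢_A|_K → 𝒢|_ℍ` is globally the covering of `𝒢|_ℍ`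
attached to `Z` ("`ℋ′ → ℍ`", [SemiAnbd] p. 30).  Same proof as the tree's `restrictGlobal_coveringHomCan`
(`Corollary27iHolds.lean`) minus its unused `IsGalois A` binder.
[cite: MochizukiSemiAnbd2006, Cor. 2.7(i) p.30] -/
theorem restrictGlobal_coveringHomCan_all :
    ∀ (𝒢 : SemiGraphOfAnabelioids.{v₁, u₁, u}) (A : 𝒢.BObj),
      𝒢.IsConnected → A.coveringGraph.IsConnected →
      ∀ (H : 𝒢.graph.Subgraph), H.toSemiGraph.IsConnected → H.toSemiGraph.IsGraph →
      ∀ (K : {K : A.coveringGraph.graph.Subgraph // A.coveringHomCan.IsPreimageComponent H K})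
        (Z : (𝒢.restrict H).BObj) (m : Z ⟶ (𝒢.restrictFunctor H).obj A), Mono m →
        (∀ (w : H.toSemiGraph.Vertex) (Fw : 𝒢.V w.1 ⥤ FintypeCat.{v₁}) [FiberFunctor Fw]
            (y : Fw.obj (A.S w.1)),
          y ∈ Set.range (Fw.map (m.fS w)) ↔ ∃ P : π₀Obj (A.S w.1),
            (∃ w'' ∈ K.1.verts,
                (⟨A.fibreData.proj.vertexMap w'', A.vComp w''⟩ : Σ v, π₀Obj (A.S v)) = ⟨w.1, P⟩) ∧
              y ∈ Set.range (Fw.map P.1.arrow)) →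
        (∀ (e : H.toSemiGraph.Edge) (Fe : 𝒢.E e.1 ⥤ FintypeCat.{v₁}) [FiberFunctor Fe]
            (x : Fe.obj (A.T e.1)),
          x ∈ Set.range (Fe.map (m.fT e)) ↔ ∃ Q : π₀Obj (A.T e.1),
            (∃ e'' ∈ K.1.edges,
                (⟨A.fibreData.proj.edgeMap e'', A.eComp e''⟩ : Σ e, π₀Obj (A.T e)) = ⟨e.1, Q⟩) ∧
              x ∈ Set.range (Fe.map Q.1.arrow)) →
        (A.coveringHomCan.restrict K.1 H K.2.2.2.2.1 K.2.2.2.2.2.1).IsGlobalCoveringOf Z := by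
  intro 𝒢 A _ _ H hH hHg K Z m hm hmS hmT
  haveI := hm
  letI := (𝒢.restrict H).preGaloisCategory_bObj
  haveI : HasBinaryProducts (𝒢.restrict H).BObj := (𝒢.restrict H).hasBinaryProducts_bObj
  -- the two indexings of the fibre characterisation of `Z` agree (verbatim from `restrictGlobal_coveringHomCan`)
  have hmS' : ∀ (w : H.toSemiGraph.Vertex) (Fw : 𝒢.V w.1 ⥤ FintypeCat.{v₁}) [FiberFunctor Fw]
      (y : Fw.obj (A.S w.1)),
      y ∈ Set.range (Fw.map (m.fS w)) ↔ ∃ c : Shrink.{u} (π₀Obj (A.S w.1)),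
        (⟨w.1, c⟩ : A.fibreData.total.Vertex) ∈ K.1.verts ∧
          y ∈ Set.range (Fw.map (A.vComp ⟨w.1, c⟩).1.arrow) := by
    intro w Fw _ y
    rw [hmS w Fw y]
    constructor
    · rintro ⟨P, ⟨⟨u, c⟩, hw'', heq⟩, hy⟩
      obtain ⟨hu, hP⟩ := Sigma.mk.inj_iff.mp heq
      change u = w.1 at hu
      subst hu
      refine ⟨c, hw'', ?_⟩
      rw [eq_of_heq hP]
      exact hy
    · rintro ⟨c, hc, hy⟩
      exact ⟨A.vComp ⟨w.1, c⟩, ⟨⟨w.1, c⟩, hc, rfl⟩, hy⟩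
  have hmT' : ∀ (e : H.toSemiGraph.Edge) (Fe : 𝒢.E e.1 ⥤ FintypeCat.{v₁}) [FiberFunctor Fe]
      (x : Fe.obj (A.T e.1)),
      x ∈ Set.range (Fe.map (m.fT e)) ↔ ∃ c : Shrink.{u} (π₀Obj (A.T e.1)),
        (⟨e.1, c⟩ : A.fibreData.total.Edge) ∈ K.1.edges ∧
          x ∈ Set.range (Fe.map (A.eComp ⟨e.1, c⟩).1.arrow) := by
    intro e Fe _ x
    rw [hmT e Fe x]
    constructor
    · rintro ⟨Q, ⟨⟨f, c⟩, he'', heq⟩, hx⟩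
      obtain ⟨hf, hQ⟩ := Sigma.mk.inj_iff.mp heq
      change f = e.1 at hf
      subst hf
      refine ⟨c, he'', ?_⟩
      rw [eq_of_heq hQ]
      exact hx
    · rintro ⟨c, hc, hx⟩
      exact ⟨A.eComp ⟨e.1, c⟩, ⟨⟨e.1, c⟩, hc, rfl⟩, hx⟩
  exact A.restrict_isGlobalCoveringOf H K.1 K.2.2.2.2.1 K.2.2.2.2.2.1
    (A.isClopenIn_of_isPreimageComponent H K.1 hHg K.2) m hmS' hmT' hH

/-! ### B. (ST) matched stabilizers at the covering of record, every object `A` -/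

/-- **(ST) «matched stabilizers at the same fibre point» for the covering of record, EVERY object `A`**
([SemiAnbd] Rem. 2.2.1 p. 24 read once in `B(𝒢_ℍ)` and once in `B(𝒢)`): for `𝒢` connected with `𝒢_A`
connected, at every vertex `w″` of every preimage component `K` of a connected sub-graph `ℍ`, for all
constituent base points `(F″, F₂, e₂)`, ONE point `a` of the fibre of `A` has
`range ι_{ψ_K} = Stab_{Π_ℍ}(a)` (`ψ_K := (𝒢_A → 𝒢)|_K`) AND `range ι = Stab_{Π_𝒢}(a)`.  (Tree so far:
`matchedStabilizers_coveringHomCan_galois`, Galois `A` only.) [cite: MochizukiSemiAnbd2006, Rem. 2.2.1 p.24] -/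
theorem matchedStabilizers_coveringHomCan :
    ∀ (𝒢 : SemiGraphOfAnabelioids.{v₁, u₁, u}) (A : 𝒢.BObj),
      𝒢.IsConnected → A.coveringGraph.IsConnected →
      ∀ (H : 𝒢.graph.Subgraph), H.toSemiGraph.IsConnected → H.toSemiGraph.IsGraph →
      ∀ (K : {K : A.coveringGraph.graph.Subgraph // A.coveringHomCan.IsPreimageComponent H K})
        (w'' : K.1.toSemiGraph.Vertex) (F'' : A.coveringGraph.V w''.1 ⥤ FintypeCat.{v₁})
        [FiberFunctor F'']
        (F₂ : 𝒢.V (A.coveringHomCan.base.vertexMap w''.1) ⥤ FintypeCat.{v₁}) [FiberFunctor F₂]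
        (e₂ : (A.coveringHomCan.φV w''.1).pullback ⋙ F'' ≅ F₂),
        ∃ a : (𝒢.ρ (A.coveringHomCan.base.vertexMap w''.1) ⋙ F₂).obj A,
          ((Aut.autMulEquivOfIso
                (isoWhiskerLeft
                  ((𝒢.restrict H).ρ ⟨A.coveringHomCan.base.vertexMap w''.1, K.2.2.2.2.1 w''.2⟩)
                  e₂)).toMonoidHom.comp
              (pi1Map (A.coveringHomCan.restrict K.1 H K.2.2.2.2.1 K.2.2.2.2.2.1).pullbackFunctor
                ((A.coveringGraph.restrict K.1).ρ w'' ⋙ F''))).range =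
            MulAction.stabilizer
              (𝒢.PiH H ⟨A.coveringHomCan.base.vertexMap w''.1, K.2.2.2.2.1 w''.2⟩ F₂)
              (show ((𝒢.restrict H).ρ ⟨A.coveringHomCan.base.vertexMap w''.1, K.2.2.2.2.1 w''.2⟩ ⋙
                F₂).obj ((𝒢.restrictFunctor H).obj A) from a) ∧
          ((Aut.autMulEquivOfIso (isoWhiskerLeft (𝒢.ρ (A.coveringHomCan.base.vertexMap w''.1)) e₂)
              ).toMonoidHom.comp
              (pi1Map A.coveringHomCan.pullbackFunctor (A.coveringGraph.ρ w''.1 ⋙ F''))).range =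
            MulAction.stabilizer (𝒢.Pi (A.coveringHomCan.base.vertexMap w''.1) F₂) a :=
  matchedStabilizers_coveringHomCan_of_restrictGlobal restrictGlobal_coveringHomCan_all

/-! ### C. (D3) at the covering of record, every object `A` -/

/-- **(D3) at the covering of record `𝒢_A → 𝒢`, EVERY object `A`** — the dictionary item
`covering_subgraphComponents_doubleCosets` (F-1487) with `𝒢′ := A.coveringGraph`, `φ := A.coveringHomCan`,
binders VERBATIM (abc-iut-w4-d071's `hD3cov` shape without `IsGalois`): for `𝒢`, `𝒢_A` connected, a
connected sub-graph `ℍ ∋ v = φ v′`, base points `(F′, F, e)` and `Π′ = ι(Π_{𝒢_A}) = Stab(x₀)`: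
(P1) `K ↦ Π_ℍ d(K) Π′` is a bijection from the preimage components of `ℍ` onto `Π_ℍ \ Π_𝒢 / Π′`;
(P2) the component through `v′` exists; (P3) it goes to the class of `Π′` and `ι(Π_{K₀}) = Π′ ∩ Π_ℍ`;
(P4) at every vertex of every component, through every transport `α`, `ι(Π_K) = Π′ ∩ g⁻¹ Π_ℍ g`.
(Tree so far: `subgraphComponents_doubleCosets_coveringHomCan_galois`, Galois `A` only.)
[cite: MochizukiSemiAnbd2006, Cor. 2.7(i) p.30] -/
theorem subgraphComponents_doubleCosets_coveringHomCan :
    ∀ (𝒢 : SemiGraphOfAnabelioids.{v₁, u₁, u}) (A : 𝒢.BObj),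
      𝒢.IsConnected → A.coveringGraph.IsConnected → A.coveringHomCan.IsFiniteEtaleCoveringOf A →
      A.coveringHomCan.IsGlobalCoveringOf A → A.coveringHomCan.IsVertexAligned →
      ∀ (v' : A.coveringGraph.graph.Vertex) (F' : A.coveringGraph.V v' ⥤ FintypeCat.{v₁})
        [FiberFunctor F'] (F : 𝒢.V (A.coveringHomCan.base.vertexMap v') ⥤ FintypeCat.{v₁})
        [FiberFunctor F] (e : (A.coveringHomCan.φV v').pullback ⋙ F' ≅ F)
        (H : 𝒢.graph.Subgraph), H.toSemiGraph.IsConnected → H.toSemiGraph.IsGraph →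
        ∀ (hv : A.coveringHomCan.base.vertexMap v' ∈ H.verts),
        let v := A.coveringHomCan.base.vertexMap v'
        let ι : A.coveringGraph.Pi v' F' →* 𝒢.Pi v F :=
          (Aut.autMulEquivOfIso (Functor.isoWhiskerLeft (𝒢.ρ v) e)).toMonoidHom.comp
            (pi1Map A.coveringHomCan.pullbackFunctor (A.coveringGraph.ρ v' ⋙ F'))
        let PH : Subgroup (𝒢.Pi v F) := (𝒢.piHToPi H ⟨v, hv⟩ F).range
        ∀ x₀ : (𝒢.ρ v ⋙ F).obj A, ι.range = MulAction.stabilizer (𝒢.Pi v F) x₀ →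
          ∃ d : {K : A.coveringGraph.graph.Subgraph // A.coveringHomCan.IsPreimageComponent H K} →
              𝒢.Pi v F,
            Function.Bijective (fun K => DoubleCoset.mk PH ι.range (d K)) ∧
            (∃ K₀ : {K : A.coveringGraph.graph.Subgraph // A.coveringHomCan.IsPreimageComponent H K},
              v' ∈ K₀.1.verts) ∧
            (∀ (K : {K : A.coveringGraph.graph.Subgraph // A.coveringHomCan.IsPreimageComponent H K})
              (hK : v' ∈ K.1.verts),
              d K ∈ ι.range ∧
                (ι.comp (A.coveringGraph.piHToPi K.1 ⟨v', hK⟩ F')).range = ι.range ⊓ PH) ∧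
            ∀ (K : {K : A.coveringGraph.graph.Subgraph // A.coveringHomCan.IsPreimageComponent H K})
              (w'' : K.1.toSemiGraph.Vertex) (F'' : A.coveringGraph.V w''.1 ⥤ FintypeCat.{v₁})
              [FiberFunctor F''] (α : A.coveringGraph.ρ w''.1 ⋙ F'' ≅ A.coveringGraph.ρ v' ⋙ F'),
              ∃ g : 𝒢.Pi v F,
                (ι.comp ((Aut.autMulEquivOfIso α).toMonoidHom.comp
                  (A.coveringGraph.piHToPi K.1 w'' F''))).range =
                    ι.range ⊓ ConjAct.toConjAct g⁻¹ • PH :=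
  subgraphComponents_doubleCosets_coveringHomCan_of_stabilizers matchedStabilizers_coveringHomCan

/-- **(D3) at the covering of record — CLEAN form, every CONNECTED object `A` of a connected `𝒢`.**
The standing clauses of `φ := A.coveringHomCan` are DISCHARGED: locally the covering attached to `A`
(`coveringHomCan_isFiniteEtaleCoveringOf`, abc-iut-L3-t5), globally (`coveringHomCan_isGlobalCoveringOf`),
vertex-aligned (`coveringHomCan_isVertexAligned`, abc-iut-w4-d071), and `𝒢_A` connected for connected `A`
((D8) `covering_isConnected_holds`).  So for `𝒢` connected, `A ∈ B(𝒢)` connected, every base vertex `v′` of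
`𝒢_A` over `v ∈ ℍ` (`ℍ` a connected sub-graph), all base points `(F′, F, e)` and every `x₀` with
`ι(Π_{𝒢_A}) = Stab(x₀)` (such `x₀` exist by (D1)), clauses (P1)–(P4) of (D3) hold for `𝒢_A → 𝒢`.
[cite: MochizukiSemiAnbd2006, Cor. 2.7(i) p.30] -/
theorem subgraphComponents_doubleCosets_coveringHomCan_of_isConnected
    {𝒢 : SemiGraphOfAnabelioids.{v₁, u₁, u}} (h𝒢 : 𝒢.IsConnected) (A : 𝒢.BObj)
    (hA : PreGaloisCategory.IsConnected A)
    (v' : A.coveringGraph.graph.Vertex) (F' : A.coveringGraph.V v' ⥤ FintypeCat.{v₁}) [FiberFunctor F']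
    (F : 𝒢.V (A.coveringHomCan.base.vertexMap v') ⥤ FintypeCat.{v₁}) [FiberFunctor F]
    (e : (A.coveringHomCan.φV v').pullback ⋙ F' ≅ F)
    (H : 𝒢.graph.Subgraph) (hH : H.toSemiGraph.IsConnected) (hHg : H.toSemiGraph.IsGraph)
    (hv : A.coveringHomCan.base.vertexMap v' ∈ H.verts)
    (x₀ : (𝒢.ρ (A.coveringHomCan.base.vertexMap v') ⋙ F).obj A)
    (hx₀ : ((Aut.autMulEquivOfIso (isoWhiskerLeft (𝒢.ρ (A.coveringHomCan.base.vertexMap v')) e)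
        ).toMonoidHom.comp
        (pi1Map A.coveringHomCan.pullbackFunctor (A.coveringGraph.ρ v' ⋙ F'))).range =
      MulAction.stabilizer (𝒢.Pi (A.coveringHomCan.base.vertexMap v') F) x₀) :
    ∃ d : {K : A.coveringGraph.graph.Subgraph // A.coveringHomCan.IsPreimageComponent H K} →
        𝒢.Pi (A.coveringHomCan.base.vertexMap v') F,
      Function.Bijective (fun K => DoubleCoset.mk
        (𝒢.piHToPi H ⟨A.coveringHomCan.base.vertexMap v', hv⟩ F).range
        ((Aut.autMulEquivOfIso (isoWhiskerLeft (𝒢.ρ (A.coveringHomCan.base.vertexMap v')) e)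
          ).toMonoidHom.comp
          (pi1Map A.coveringHomCan.pullbackFunctor (A.coveringGraph.ρ v' ⋙ F'))).range (d K)) ∧
      (∃ K₀ : {K : A.coveringGraph.graph.Subgraph // A.coveringHomCan.IsPreimageComponent H K},
        v' ∈ K₀.1.verts) ∧
      (∀ (K : {K : A.coveringGraph.graph.Subgraph // A.coveringHomCan.IsPreimageComponent H K})
        (hK : v' ∈ K.1.verts),
        d K ∈ ((Aut.autMulEquivOfIso (isoWhiskerLeft (𝒢.ρ (A.coveringHomCan.base.vertexMap v')) e)
            ).toMonoidHom.comp
            (pi1Map A.coveringHomCan.pullbackFunctor (A.coveringGraph.ρ v' ⋙ F'))).range ∧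
          (((Aut.autMulEquivOfIso (isoWhiskerLeft (𝒢.ρ (A.coveringHomCan.base.vertexMap v')) e)
              ).toMonoidHom.comp
              (pi1Map A.coveringHomCan.pullbackFunctor (A.coveringGraph.ρ v' ⋙ F'))).comp
              (A.coveringGraph.piHToPi K.1 ⟨v', hK⟩ F')).range =
            ((Aut.autMulEquivOfIso (isoWhiskerLeft (𝒢.ρ (A.coveringHomCan.base.vertexMap v')) e)
                ).toMonoidHom.comp
                (pi1Map A.coveringHomCan.pullbackFunctor (A.coveringGraph.ρ v' ⋙ F'))).range ⊓
              (𝒢.piHToPi H ⟨A.coveringHomCan.base.vertexMap v', hv⟩ F).range) ∧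
      ∀ (K : {K : A.coveringGraph.graph.Subgraph // A.coveringHomCan.IsPreimageComponent H K})
        (w'' : K.1.toSemiGraph.Vertex) (F'' : A.coveringGraph.V w''.1 ⥤ FintypeCat.{v₁})
        [FiberFunctor F''] (α : A.coveringGraph.ρ w''.1 ⋙ F'' ≅ A.coveringGraph.ρ v' ⋙ F'),
        ∃ g : 𝒢.Pi (A.coveringHomCan.base.vertexMap v') F,
          (((Aut.autMulEquivOfIso (isoWhiskerLeft (𝒢.ρ (A.coveringHomCan.base.vertexMap v')) e)
              ).toMonoidHom.comp
              (pi1Map A.coveringHomCan.pullbackFunctor (A.coveringGraph.ρ v' ⋙ F'))).comp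
              ((Aut.autMulEquivOfIso α).toMonoidHom.comp
                (A.coveringGraph.piHToPi K.1 w'' F''))).range =
            ((Aut.autMulEquivOfIso (isoWhiskerLeft (𝒢.ρ (A.coveringHomCan.base.vertexMap v')) e)
                ).toMonoidHom.comp
                (pi1Map A.coveringHomCan.pullbackFunctor (A.coveringGraph.ρ v' ⋙ F'))).range ⊓
              ConjAct.toConjAct g⁻¹ •
                (𝒢.piHToPi H ⟨A.coveringHomCan.base.vertexMap v', hv⟩ F).range := by
  have h𝒢A : A.coveringGraph.IsConnected :=
    covering_isConnected_holds 𝒢 A.coveringGraph A.coveringHomCan A h𝒢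
      A.coveringHomCan_isFiniteEtaleCoveringOf hA
  have h := subgraphComponents_doubleCosets_coveringHomCan 𝒢 A h𝒢 h𝒢A
    A.coveringHomCan_isFiniteEtaleCoveringOf A.coveringHomCan_isGlobalCoveringOf
    A.coveringHomCan_isVertexAligned v' F' F e H hH hHg hv
  exact h x₀ hx₀

end SemiGraphOfAnabelioids

end Literature.AnabelianGeometry.SemiGraphs
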